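import Summits.CriticalPhenomena.PercolationContinuityZ3.Theorems.PercNearOneGluingNoHeavyLowerTailSahiCombTriWSharp

/-!
# `TRI_W(a) ≥ 0` when, along every antipodal pair of levels, the two families are co-nested OR one of them is constant on the pair
# (for `a = 2`: equal middle levels `G {a} = G {b}` or `F {a} = F {b}` suffice) — the SWAP mechanism

Support file of the one-cut programme (crux `NoHeavyLowerTail`, stmt-CriticalPhenomena-4575; cell `prim-masterthm`, seat P5 gen 21; memo
`FROM-prim-masterthm-p5-g21-SELF-DUAL-AND-FACES.md` §8).

By the pair decomposition `2 · triW P F G = Σ_x triWOne(P; F x, F xᶜ; G x, G xᶜ)` (`FiveUpSet.two_mul_triW`), `TriWIneq` is a statement about the thin-edge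
functional of two (in general NON-nested) pairs.  `…SahiCombTriWGeneral` (`triW_nonneg_of_pairwise_nested`) handles the pairs that are CO-NESTED (five-up-set
theorem).  Here we add the pairs on which ONE FAMILY IS CONSTANT: if `B = B'` then
`triWOne(P; A, A'; B, B) = [#(P∩A∩B) − #(P∩refl A∩B)] + [#(P∩A∩B) − #(P∩A∩refl B)] + [#(P∩A'∩B) − #(P∩refl A'∩B)] + [#(P∩A'∩B) − #(P∩A'∩refl B)]`
— four Kleitman gaps (the two doubly-antipodal counts cancel), for ARBITRARY up-sets `A, A'` (`triWOne_nonneg_of_right_eq`, `…_of_left_eq`).  Consequences: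

* **`FiveUpSet.triW_nonneg_of_pairwise_nested_or_const`** — `0 ≤ triW P F G` whenever for every `x` the pairs `(F x, F xᶜ)`, `(G x, G xᶜ)` are co-nested,
  or `F x = F xᶜ`, or `G x = G xᶜ` (every index cube, every cube; the families need not even be monotone);
* **`FiveUpSet.triW_nonneg_of_mid_eq_right` / `_left`** — `a = 2` (`univ = {a, b}`): `0 ≤ triW P F G` for ALL monotone families of up-sets `F` as soon as
  `G {a} = G {b}` (resp. for all `G` as soon as `F {a} = F {b}`).  This "level-swap-symmetric" stratum is exactly where every uniform tilt certificate of the rank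
  route is deficient (P5 gen 20, kit j151773: all 144 deficient (2,4) configurations have `F₁₀ = F₀₁`) — there the inequality is four Kleitman gaps + one five-up-set.
Behind it (memo §8, `a = 2`): swapping the middle levels of `G` is an involution of monotone families that flips the sign of the "orientation" part of `triW` and fixes
the rest, so `triW P F G + triW P F G^{swap} = 2Σ` with `Σ = triWOne(P;F ∅,F univ;G ∅,G univ) + ½·Occ ≥ 0` (five-up-set + eight Kleitman gaps), and
`TriWIneq (a = 2) ⟺ |triW P F G − triW P F G^{swap}| ≤ triW P F G + triW P F G^{swap}`.
HONEST LABEL: unconditional strata (std axioms); `TriWIneq` for `a ≥ 2` with both middle pairs incomparable remains OPEN. [this work]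
-/

namespace Summit.CriticalPhenomena.PercolationContinuityZ3.Theorems

namespace FiveUpSet

open Finset

variable {β γ : Type} [DecidableEq β] [Fintype β] [DecidableEq γ] [Fintype γ]

omit [DecidableEq β] [Fintype β] in
/-- The thin-edge functional of a pair `(A, A')` against a CONSTANT pair `(B, B)` is a sum of four Kleitman gaps, hence `≥ 0`, for arbitrary up-sets
`P, A, A', B` (no nesting of `A, A'` needed). [this work] -/
theorem triWOne_nonneg_of_right_eq (P A A' B : Finset (Finset γ)) (hP : IsUpperSet (P : Set (Finset γ)))
    (hA : IsUpperSet (A : Set (Finset γ))) (hA' : IsUpperSet (A' : Set (Finset γ))) (hB : IsUpperSet (B : Set (Finset γ))) :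
    0 ≤ LatticeFiveUpSet.triWOne (complEquiv γ) P A A' B B := by
  unfold LatticeFiveUpSet.triWOne
  simp only [image_complEquiv]
  have hPA : IsUpperSet ((P ∩ A : Finset (Finset γ)) : Set (Finset γ)) := by rw [coe_inter]; exact hP.inter hA
  have hPA' : IsUpperSet ((P ∩ A' : Finset (Finset γ)) : Set (Finset γ)) := by rw [coe_inter]; exact hP.inter hA'
  have hPB : IsUpperSet ((P ∩ B : Finset (Finset γ)) : Set (Finset γ)) := by rw [coe_inter]; exact hP.inter hB
  have k1 : (P ∩ B ∩ refl A).card ≤ (P ∩ B ∩ A).card := card_inter_refl_le hPB hA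
  have k2 : (P ∩ A ∩ refl B).card ≤ (P ∩ A ∩ B).card := card_inter_refl_le hPA hB
  have k3 : (P ∩ B ∩ refl A').card ≤ (P ∩ B ∩ A').card := card_inter_refl_le hPB hA'
  have k4 : (P ∩ A' ∩ refl B).card ≤ (P ∩ A' ∩ B).card := card_inter_refl_le hPA' hB
  have e1 : P ∩ B ∩ refl A = P ∩ refl A ∩ B := by rw [inter_right_comm]
  have e1' : P ∩ B ∩ A = P ∩ A ∩ B := by rw [inter_right_comm]
  have e3 : P ∩ B ∩ refl A' = P ∩ refl A' ∩ B := by rw [inter_right_comm]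
  have e3' : P ∩ B ∩ A' = P ∩ A' ∩ B := by rw [inter_right_comm]
  rw [e1, e1'] at k1
  rw [e3, e3'] at k3
  omega

omit [DecidableEq β] [Fintype β] in
/-- Mirror image: constant left pair `(A, A)`, arbitrary right pair `(B, B')`. [this work] -/
theorem triWOne_nonneg_of_left_eq (P A B B' : Finset (Finset γ)) (hP : IsUpperSet (P : Set (Finset γ)))
    (hA : IsUpperSet (A : Set (Finset γ))) (hB : IsUpperSet (B : Set (Finset γ))) (hB' : IsUpperSet (B' : Set (Finset γ))) :
    0 ≤ LatticeFiveUpSet.triWOne (complEquiv γ) P A A B B' := by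
  have hsym : LatticeFiveUpSet.triWOne (complEquiv γ) P A A B B'
      = LatticeFiveUpSet.triWOne (complEquiv γ) P B B' A A := by
    unfold LatticeFiveUpSet.triWOne
    simp only [inter_right_comm]
    ring
  rw [hsym]
  exact triWOne_nonneg_of_right_eq P B B' A hP hB hB' hA

/-- **`TRI_W(a) ≥ 0` when every antipodal level pair is co-nested or carries a constant family.**  If for every `x` either
`F x ⊆ F xᶜ ∧ G x ⊆ G xᶜ`, or `F xᶜ ⊆ F x ∧ G xᶜ ⊆ G x`, or `F x = F xᶜ`, or `G x = G xᶜ`, then `0 ≤ triW P F G` for all up-sets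
(every index cube `Finset β`, every cube `Finset γ`; extends `triW_nonneg_of_pairwise_nested`). [this work] -/
theorem triW_nonneg_of_pairwise_nested_or_const (P : Finset (Finset γ)) (F G : Finset β → Finset (Finset γ))
    (hP : IsUpperSet (P : Set (Finset γ))) (hF : ∀ x, IsUpperSet (F x : Set (Finset γ)))
    (hG : ∀ x, IsUpperSet (G x : Set (Finset γ)))
    (h : ∀ x, (F x ⊆ F xᶜ ∧ G x ⊆ G xᶜ) ∨ (F xᶜ ⊆ F x ∧ G xᶜ ⊆ G x) ∨ F x = F xᶜ ∨ G x = G xᶜ) :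
    0 ≤ triW P F G := by
  have h2 : 0 ≤ 2 * triW P F G := by
    rw [two_mul_triW]
    refine sum_nonneg fun x _ => ?_
    rcases h x with ⟨hFx, hGx⟩ | ⟨hFx, hGx⟩ | hFx | hGx
    · exact triWOne_nonneg_cube γ P (F x) (F xᶜ) (G x) (G xᶜ) hP (hF x) (hF xᶜ) (hG x) (hG xᶜ) hFx hGx
    · have hsym : LatticeFiveUpSet.triWOne (complEquiv γ) P (F x) (F xᶜ) (G x) (G xᶜ)
          = LatticeFiveUpSet.triWOne (complEquiv γ) P (F xᶜ) (F x) (G xᶜ) (G x) := by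
        unfold LatticeFiveUpSet.triWOne; ring
      rw [hsym]
      exact triWOne_nonneg_cube γ P (F xᶜ) (F x) (G xᶜ) (G x) hP (hF xᶜ) (hF x) (hG xᶜ) (hG x) hFx hGx
    · rw [← hFx]
      exact triWOne_nonneg_of_left_eq P (F x) (G x) (G xᶜ) hP (hF x) (hG x) (hG xᶜ)
    · rw [← hGx]
      exact triWOne_nonneg_of_right_eq P (F x) (F xᶜ) (G x) hP (hF x) (hF xᶜ) (hG x)
  omega

/-- In a two-coordinate index cube `{a, b}`, every index is one of `∅, {a}, {b}, univ`. [folklore] -/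
theorem eq_of_univ_pair {a b : β} (hu : (univ : Finset β) = {a, b}) (x : Finset β) :
    x = ∅ ∨ x = {a} ∨ x = {b} ∨ x = univ := by
  have hsub : x ⊆ {a, b} := hu ▸ subset_univ x
  by_cases ha : a ∈ x <;> by_cases hb : b ∈ x
  · right; right; right
    exact eq_univ_of_forall fun c => by
      have hc : c ∈ ({a, b} : Finset β) := hu ▸ mem_univ c
      rw [mem_insert, mem_singleton] at hc
      rcases hc with rfl | rfl
      · exact ha
      · exact hb
  · right; left
    ext c; rw [mem_singleton]
    constructor
    · intro hc
      have hc' := hsub hc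
      rw [mem_insert, mem_singleton] at hc'
      rcases hc' with rfl | rfl
      · rfl
      · exact absurd hc hb
    · rintro rfl; exact ha
  · right; right; left
    ext c; rw [mem_singleton]
    constructor
    · intro hc
      have hc' := hsub hc
      rw [mem_insert, mem_singleton] at hc'
      rcases hc' with rfl | rfl
      · exact absurd hc ha
      · rfl
    · rintro rfl; exact hb
  · left
    ext c
    simp only [Finset.notMem_empty, iff_false]
    intro hc
    have hc' := hsub hc
    rw [mem_insert, mem_singleton] at hc'
    rcases hc' with rfl | rfl
    · exact ha hc
    · exact hb hc

/-- **`a = 2`: equal middle levels of `G` suffice.**  If the index cube has two coordinates `a ≠ b` and `G {a} = G {b}`, then `0 ≤ triW P F G` for every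
up-set `P` and all monotone families of up-sets `F, G` — whatever the (incomparable) middle levels of `F` are.  (The level-swap-symmetric stratum where
every uniform tilt certificate of the rank route is deficient, P5 gen 20.) [this work] -/
theorem triW_nonneg_of_mid_eq_right {a b : β} (hab : a ≠ b) (hu : (univ : Finset β) = {a, b})
    (P : Finset (Finset γ)) (F G : Finset β → Finset (Finset γ))
    (hP : IsUpperSet (P : Set (Finset γ))) (hF : ∀ x, IsUpperSet (F x : Set (Finset γ))) (hG : ∀ x, IsUpperSet (G x : Set (Finset γ)))
    (hFm : Monotone F) (hGm : Monotone G) (hGab : G {a} = G {b}) :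
    0 ≤ triW P F G := by
  have hca : ({a} : Finset β)ᶜ = {b} := compl_singleton_eq_of_univ hab hu
  have hcb : ({b} : Finset β)ᶜ = {a} := by
    rw [← hca, compl_compl]
  refine triW_nonneg_of_pairwise_nested_or_const P F G hP hF hG fun x => ?_
  rcases eq_of_univ_pair hu x with rfl | rfl | rfl | rfl
  · left; exact ⟨hFm (empty_subset _), hGm (empty_subset _)⟩
  · right; right; right; rw [hca]; exact hGab
  · right; right; right; rw [hcb]; exact hGab.symm
  · right; left; rw [compl_univ]; exact ⟨hFm (empty_subset _), hGm (empty_subset _)⟩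

/-- **`a = 2`: equal middle levels of `F` suffice.** [this work] -/
theorem triW_nonneg_of_mid_eq_left {a b : β} (hab : a ≠ b) (hu : (univ : Finset β) = {a, b})
    (P : Finset (Finset γ)) (F G : Finset β → Finset (Finset γ))
    (hP : IsUpperSet (P : Set (Finset γ))) (hF : ∀ x, IsUpperSet (F x : Set (Finset γ))) (hG : ∀ x, IsUpperSet (G x : Set (Finset γ)))
    (hFm : Monotone F) (hGm : Monotone G) (hFab : F {a} = F {b}) :
    0 ≤ triW P F G := by
  have hca : ({a} : Finset β)ᶜ = {b} := compl_singleton_eq_of_univ hab hu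
  have hcb : ({b} : Finset β)ᶜ = {a} := by
    rw [← hca, compl_compl]
  refine triW_nonneg_of_pairwise_nested_or_const P F G hP hF hG fun x => ?_
  rcases eq_of_univ_pair hu x with rfl | rfl | rfl | rfl
  · left; exact ⟨hFm (empty_subset _), hGm (empty_subset _)⟩
  · right; right; left; rw [hca]; exact hFab
  · right; right; left; rw [hcb]; exact hFab.symm
  · right; left; rw [compl_univ]; exact ⟨hFm (empty_subset _), hGm (empty_subset _)⟩

end FiveUpSet

end Summit.CriticalPhenomena.PercolationContinuityZ3.Theorems
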